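import Literature.MathematicalPhysics.QuantumFieldTheory.Balaban1983to89.B10SectAGathering

/-!
# `Balaban3D.Proofs.OldOutsideShells` — [B10] p. 272 L28–31 «we estimate a sum of all terms 𝒫_j(Y_j, U_{k+1}) with
# localizations Y_j not contained in Ω_{k+1} by O(1)|Λ_k|, or by O(1)|Z_k|» with a k-UNIFORM O(1): the absorption the
# print leaves unwritten (pub-balaban GAPS G-B10-07 (b)), by DISTANCE SHELLS around Z_k — a dropped term has its big
# block y within reach max_i|c_{i,−} − y| of Z_k, (44)'s factor exp(−κ₁(M₁Lʲη)⁻¹|c_{i,−} − y|) pays e^{−κ′·dist(y, Z_k)},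
# and the number of scale-j blocks within m shells of Z_k is ≤ c_sh(m+1)³·(M₁Lʲη)⁻³|Z_k|; summed: O(1)(Lʲη)·M₁⁻³|Z_k| per
# scale, Σ_j Lʲη ≤ L/(L−1) (d = 3 power counting, (45)–(46) p. 267)

Lane «pub-balaban3d», seat p5; LEAF-LEDGER row C10 (`oldOutside`).  Companion of `ZtermOldOutside.oldOutside_of_allScales`
(the LQB polymer/tree-decay reading); THIS file is the reading compatible with p2's literal (43)–(46) term sizes indexed by
(y; c₁, …, c_n) (rows (43)–(45), B15): its analytic hypothesis `hshell` is the (44)/(45)-type per-block bound WITH the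
decay in the distance of y from Z_k, its geometric hypothesis `hcount` the shell count on p1's block lattice (p2
`TorusBalls.card_torusBall_le`), its `hdiff` the triangle inequality over p1's definitions of `Pold`/`PoldIn`.  Kernel
bookkeeping only (finite sums, one exponential series); no definition, no named fact.  Why shells and not a plain
count: counting ALL blocks within the localization radius R(g_j)M₁Lʲη of Z_k would give O(R(g_j)³)|Z_k| =
O((1 + log g_j⁻¹)^{3r₀})|Z_k|, not the printed O(1) (and not the «O(log g_j⁻¹)|Z_j|» shape of (41) that the large-field
control of Sect. D consumes); the exponential factor of (44) removes the logarithms.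

THE PRINTED TEXT (renders p013 = p. 267, p018 = p. 272 read as images): (44) p. 267 L4–6 «|𝒫_j(Y_j, U_k)| ≦ O(1) Π_{i=1}^n
exp(−κ₁(M₁Lʲη)⁻¹|c_{i,−} − y|) × (Lʲη)⁻¹|c_{i,−} − y|8L²B₃g_{k−1}p(g_{k−1})(Lʲη)².»; (45) L8–10 «By the assumption n ≧ 2,
summation over all Y_j with y fixed yields for g_{k−1} sufficiently small Σ_{Y_j: y = y₀} |𝒫_j(Y_j, U_k)| ≦
O(1)(O(M₁³)g_{k−1}p(g_{k−1}))²(Lʲη)⁴.»; L11–12 «Summation over y gives the factor (M₁Lʲη)⁻³|Λ_k|, and finally summation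
over j = 1, …, k gives … (46)»; p. 272 L28–31 (quoted in the title).

WHAT IS PROVED.
* `shell_series_le` — `Σ_{m<M} (m+1)³e^{−κm} ≤ 48e^{κ/2}/(κ³(1 − e^{−κ/2}))` for `κ > 0` (any M).
* `sum_exp_neg_dist_le` — layer-cake: `#{y : dist y ≤ m} ≤ c_sh(m+1)³·Zb` for all m ⇒ `Σ_y e^{−κ·dist y} ≤ c_sh·S·Zb` for
  any series majorant S.
* `dropped_scale_le` — one scale: per-block dropped masses `drop y ≤ A·e^{−κ·dist y}` ⇒ `Σ_y drop y ≤ A·c_sh·S·Zb`.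
* `sum_exp_neg_dist_le_finset`, `dropped_scale_le_finset`, `oldOutside_of_shells_finset` — the same over
  history-dependent finite block sets (the carrier's form).
* `oldOutside_of_shells` — all scales j = 1..k with `A_j = A₀(Lʲη)⁴`, `Zb_j = (M₁Lʲη)⁻³|Z_k|`, `Lʲη = L^{j−k}`:
  `OldOutside P (A₀·c_sh·S·M₁⁻³·(L/(L−1)))` — the constant is k- and ε-INDEPENDENT (R-CONST `C₆`).
[cite: Balaban1985UV3, Thm 2 proof p.272 + (44)–(46) p.267]
-/

open Finset
open scoped BigOperators

namespace Summit.QuantumFields.Balaban3D.Proofs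

open Literature.MathematicalPhysics.QuantumFieldTheory.Balaban1983to89
open Literature.MathematicalPhysics.QuantumFieldTheory.Balaban1983to89.B10 (TowerRun)
open Literature.MathematicalPhysics.QuantumFieldTheory.Balaban1983to89.B10SectAGathering (StepPieces OldOutside)

/-! ## §1 The exponential series over distance shells -/

/-- `(m+1)³ ≤ (48/κ³)·e^{κ/2}·e^{κm/2}` for `κ > 0` (from `x³/3! ≤ eˣ` at `x = (κ/2)(m+1)`). [folklore] -/
theorem cube_le_exp (κ : ℝ) (hκ : 0 < κ) (m : ℕ) :
    ((m : ℝ) + 1) ^ 3 ≤ 48 / κ ^ 3 * Real.exp (κ / 2) * Real.exp (κ / 2 * m) := by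
  have hx : 0 ≤ κ / 2 * ((m : ℝ) + 1) := by positivity
  have h := Real.pow_div_factorial_le_exp _ hx 3
  have h3 : ((3 : ℕ).factorial : ℝ) = 6 := by norm_num [Nat.factorial]
  rw [h3, div_le_iff₀ (by norm_num : (0 : ℝ) < 6)] at h
  have hexp : Real.exp (κ / 2 * ((m : ℝ) + 1)) = Real.exp (κ / 2) * Real.exp (κ / 2 * m) := by
    rw [← Real.exp_add]; ring_nf
  rw [hexp] at h
  have hκ3 : 0 < κ ^ 3 := pow_pos hκ 3
  -- (κ/2)^3 (m+1)^3 ≤ 6 e^{κ/2} e^{κ m/2}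
  have h' : κ ^ 3 * ((m : ℝ) + 1) ^ 3 ≤ 48 * (Real.exp (κ / 2) * Real.exp (κ / 2 * m)) := by
    have : (κ / 2 * ((m : ℝ) + 1)) ^ 3 = κ ^ 3 * ((m : ℝ) + 1) ^ 3 / 8 := by ring
    rw [this] at h
    linarith
  rw [div_mul_eq_mul_div, div_mul_eq_mul_div, le_div_iff₀ hκ3]
  linarith

/-- **The shell series**: for `κ > 0` and every `M`, `Σ_{m<M} (m+1)³e^{−κm} ≤ 48e^{κ/2}/(κ³(1 − e^{−κ/2}))`. [folklore] -/
theorem shell_series_le {κ : ℝ} (hκ : 0 < κ) (M : ℕ) :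
    ∑ m ∈ Finset.range M, ((m : ℝ) + 1) ^ 3 * Real.exp (-(κ * m))
      ≤ 48 / κ ^ 3 * Real.exp (κ / 2) / (1 - Real.exp (-(κ / 2))) := by
  set r : ℝ := Real.exp (-(κ / 2)) with hr
  have hr0 : 0 ≤ r := (Real.exp_pos _).le
  have hr1 : r < 1 := by rw [hr]; exact Real.exp_lt_one_iff.mpr (by linarith)
  have hK : 0 ≤ 48 / κ ^ 3 * Real.exp (κ / 2) := by positivity
  -- termwise: (m+1)^3 e^{-κ m} ≤ K r^m
  have hterm : ∀ m : ℕ, ((m : ℝ) + 1) ^ 3 * Real.exp (-(κ * m)) ≤ 48 / κ ^ 3 * Real.exp (κ / 2) * r ^ m := by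
    intro m
    have h1 := cube_le_exp κ hκ m
    have he : Real.exp (κ / 2 * m) * Real.exp (-(κ * m)) = r ^ m := by
      rw [hr, ← Real.exp_nat_mul, ← Real.exp_add]; ring_nf
    calc ((m : ℝ) + 1) ^ 3 * Real.exp (-(κ * m))
        ≤ (48 / κ ^ 3 * Real.exp (κ / 2) * Real.exp (κ / 2 * m)) * Real.exp (-(κ * m)) :=
          mul_le_mul_of_nonneg_right h1 (Real.exp_pos _).le
      _ = 48 / κ ^ 3 * Real.exp (κ / 2) * r ^ m := by rw [mul_assoc, he]
  have hgeom : ∑ m ∈ Finset.range M, r ^ m ≤ 1 / (1 - r) := by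
    have h1r : 0 < 1 - r := by linarith
    have key := mul_neg_geom_sum r M
    rw [le_div_iff₀ h1r, mul_comm, key]
    linarith [pow_nonneg hr0 M]
  calc ∑ m ∈ Finset.range M, ((m : ℝ) + 1) ^ 3 * Real.exp (-(κ * m))
      ≤ ∑ m ∈ Finset.range M, 48 / κ ^ 3 * Real.exp (κ / 2) * r ^ m := Finset.sum_le_sum fun m _ => hterm m
    _ = 48 / κ ^ 3 * Real.exp (κ / 2) * ∑ m ∈ Finset.range M, r ^ m := by rw [Finset.mul_sum]
    _ ≤ 48 / κ ^ 3 * Real.exp (κ / 2) * (1 / (1 - r)) := mul_le_mul_of_nonneg_left hgeom hK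
    _ = 48 / κ ^ 3 * Real.exp (κ / 2) / (1 - r) := by ring

/-! ## §2 Layer-cake over the distance to Z_k -/

section Layer

variable {B : Type*} [Fintype B]

/-- **Layer-cake**: if the number of blocks within `m` shells of `Z_k` is `≤ c_sh·(m+1)³·Zb` for every `m` and
`Σ_{m<M}(m+1)³e^{−κm} ≤ S` for every `M`, then `Σ_y e^{−κ·dist y} ≤ c_sh·S·Zb`. [folklore] -/
theorem sum_exp_neg_dist_le (dist : B → ℕ) {κ csh Zb S : ℝ} (hcsh : 0 ≤ csh) (hZb : 0 ≤ Zb)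
    (hcount : ∀ m : ℕ, ((Finset.univ.filter fun y => dist y ≤ m).card : ℝ) ≤ csh * ((m : ℝ) + 1) ^ 3 * Zb)
    (hS : ∀ M : ℕ, ∑ m ∈ Finset.range M, ((m : ℝ) + 1) ^ 3 * Real.exp (-(κ * m)) ≤ S) :
    ∑ y, Real.exp (-(κ * dist y)) ≤ csh * S * Zb := by
  classical
  -- regroup by the value of `dist`
  rw [Finset.sum_comp (fun m : ℕ => Real.exp (-(κ * m))) dist]
  set M : ℕ := (Finset.univ.image dist).sup id + 1 with hM
  have himg : Finset.univ.image dist ⊆ Finset.range M := by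
    intro m hm
    rw [Finset.mem_range, hM]
    exact Nat.lt_succ_of_le (Finset.le_sup (f := id) hm)
  calc ∑ m ∈ Finset.univ.image dist, ((Finset.univ.filter fun y => dist y = m).card : ℕ) • Real.exp (-(κ * m))
      ≤ ∑ m ∈ Finset.univ.image dist, csh * ((m : ℝ) + 1) ^ 3 * Zb * Real.exp (-(κ * m)) := by
        refine Finset.sum_le_sum fun m _ => ?_
        rw [nsmul_eq_mul]
        refine mul_le_mul_of_nonneg_right ?_ (Real.exp_pos _).le
        refine le_trans ?_ (hcount m)
        exact_mod_cast Finset.card_le_card fun y hy => by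
          rw [Finset.mem_filter] at hy ⊢
          exact ⟨hy.1, hy.2.le⟩
    _ ≤ ∑ m ∈ Finset.range M, csh * ((m : ℝ) + 1) ^ 3 * Zb * Real.exp (-(κ * m)) :=
        Finset.sum_le_sum_of_subset_of_nonneg himg fun m _ _ => by positivity
    _ = csh * Zb * ∑ m ∈ Finset.range M, ((m : ℝ) + 1) ^ 3 * Real.exp (-(κ * m)) := by
        rw [Finset.mul_sum]; exact Finset.sum_congr rfl fun m _ => by ring
    _ ≤ csh * Zb * S := mul_le_mul_of_nonneg_left (hS M) (mul_nonneg hcsh hZb)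
    _ = csh * S * Zb := by ring

/-- **One scale**: per-block dropped masses with `drop y ≤ A·e^{−κ·dist y}` (`A ≥ 0`) sum to `≤ A·c_sh·S·Zb`.
[cite: Balaban1985UV3, (45) p.267 + Thm 2 proof p.272] -/
theorem dropped_scale_le (drop : B → ℝ) (dist : B → ℕ) {A κ csh Zb S : ℝ} (hA : 0 ≤ A) (hcsh : 0 ≤ csh)
    (hZb : 0 ≤ Zb) (hshell : ∀ y, drop y ≤ A * Real.exp (-(κ * dist y)))
    (hcount : ∀ m : ℕ, ((Finset.univ.filter fun y => dist y ≤ m).card : ℝ) ≤ csh * ((m : ℝ) + 1) ^ 3 * Zb)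
    (hS : ∀ M : ℕ, ∑ m ∈ Finset.range M, ((m : ℝ) + 1) ^ 3 * Real.exp (-(κ * m)) ≤ S) :
    ∑ y, drop y ≤ A * (csh * S * Zb) := by
  calc ∑ y, drop y ≤ ∑ y, A * Real.exp (-(κ * dist y)) := Finset.sum_le_sum fun y _ => hshell y
    _ = A * ∑ y, Real.exp (-(κ * dist y)) := by rw [Finset.mul_sum]
    _ ≤ A * (csh * S * Zb) := mul_le_mul_of_nonneg_left (sum_exp_neg_dist_le dist hcsh hZb hcount hS) hA

/-- **Layer-cake over a finite set of blocks** (the form the carrier uses: the scale-j big blocks of Ω_k as a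
`Finset`, history-dependent): `#{y ∈ s : dist y ≤ m} ≤ c_sh·(m+1)³·Zb` for every `m` and the series majorant `S` give
`Σ_{y ∈ s} e^{−κ·dist y} ≤ c_sh·S·Zb`. [folklore] -/
theorem sum_exp_neg_dist_le_finset {B : Type*} (s : Finset B) (dist : B → ℕ) {κ csh Zb S : ℝ} (hcsh : 0 ≤ csh)
    (hZb : 0 ≤ Zb)
    (hcount : ∀ m : ℕ, ((s.filter fun y => dist y ≤ m).card : ℝ) ≤ csh * ((m : ℝ) + 1) ^ 3 * Zb)
    (hS : ∀ M : ℕ, ∑ m ∈ Finset.range M, ((m : ℝ) + 1) ^ 3 * Real.exp (-(κ * m)) ≤ S) :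
    ∑ y ∈ s, Real.exp (-(κ * dist y)) ≤ csh * S * Zb := by
  classical
  rw [Finset.sum_comp (fun m : ℕ => Real.exp (-(κ * m))) dist]
  set M : ℕ := (s.image dist).sup id + 1 with hM
  have himg : s.image dist ⊆ Finset.range M := by
    intro m hm
    rw [Finset.mem_range, hM]
    exact Nat.lt_succ_of_le (Finset.le_sup (f := id) hm)
  calc ∑ m ∈ s.image dist, ((s.filter fun y => dist y = m).card : ℕ) • Real.exp (-(κ * m))
      ≤ ∑ m ∈ s.image dist, csh * ((m : ℝ) + 1) ^ 3 * Zb * Real.exp (-(κ * m)) := by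
        refine Finset.sum_le_sum fun m _ => ?_
        rw [nsmul_eq_mul]
        refine mul_le_mul_of_nonneg_right ?_ (Real.exp_pos _).le
        refine le_trans ?_ (hcount m)
        exact_mod_cast Finset.card_le_card fun y hy => by
          rw [Finset.mem_filter] at hy ⊢
          exact ⟨hy.1, hy.2.le⟩
    _ ≤ ∑ m ∈ Finset.range M, csh * ((m : ℝ) + 1) ^ 3 * Zb * Real.exp (-(κ * m)) :=
        Finset.sum_le_sum_of_subset_of_nonneg himg fun m _ _ => by positivity
    _ = csh * Zb * ∑ m ∈ Finset.range M, ((m : ℝ) + 1) ^ 3 * Real.exp (-(κ * m)) := by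
        rw [Finset.mul_sum]; exact Finset.sum_congr rfl fun m _ => by ring
    _ ≤ csh * Zb * S := mul_le_mul_of_nonneg_left (hS M) (mul_nonneg hcsh hZb)
    _ = csh * S * Zb := by ring

/-- **One scale over a finite block set**: `drop y ≤ A·e^{−κ·dist y}` on `s` ⇒ `Σ_{y∈s} drop y ≤ A·c_sh·S·Zb`.
[cite: Balaban1985UV3, (45) p.267 + Thm 2 proof p.272] -/
theorem dropped_scale_le_finset {B : Type*} (s : Finset B) (drop : B → ℝ) (dist : B → ℕ) {A κ csh Zb S : ℝ}
    (hA : 0 ≤ A) (hcsh : 0 ≤ csh) (hZb : 0 ≤ Zb) (hshell : ∀ y ∈ s, drop y ≤ A * Real.exp (-(κ * dist y)))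
    (hcount : ∀ m : ℕ, ((s.filter fun y => dist y ≤ m).card : ℝ) ≤ csh * ((m : ℝ) + 1) ^ 3 * Zb)
    (hS : ∀ M : ℕ, ∑ m ∈ Finset.range M, ((m : ℝ) + 1) ^ 3 * Real.exp (-(κ * m)) ≤ S) :
    ∑ y ∈ s, drop y ≤ A * (csh * S * Zb) := by
  calc ∑ y ∈ s, drop y ≤ ∑ y ∈ s, A * Real.exp (-(κ * dist y)) := Finset.sum_le_sum hshell
    _ = A * ∑ y ∈ s, Real.exp (-(κ * dist y)) := by rw [Finset.mul_sum]
    _ ≤ A * (csh * S * Zb) := mul_le_mul_of_nonneg_left (sum_exp_neg_dist_le_finset s dist hcsh hZb hcount hS) hA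

end Layer

/-! ## §3 All scales: the leaf `OldOutside` with a k-uniform constant -/

section AllScales

variable {T : TowerRun} {k : ℕ}

/-- `Σ_{j=1}^{k} q^{k−j} = Σ_{m<k} q^m` (reindex `j ↦ k − j`). [folklore] -/
theorem sum_Icc_pow_sub (q : ℝ) (k : ℕ) :
    ∑ j ∈ Finset.Icc 1 k, q ^ (k - j) = ∑ m ∈ Finset.range k, q ^ m := by
  refine Finset.sum_nbij' (fun j => k - j) (fun m => k - m) ?_ ?_ ?_ ?_ ?_
  · intro j hj
    rw [Finset.mem_Icc] at hj
    rw [Finset.mem_range]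
    omega
  · intro m hm
    rw [Finset.mem_range] at hm
    rw [Finset.mem_Icc]
    omega
  · intro j hj
    rw [Finset.mem_Icc] at hj
    show k - (k - j) = j
    omega
  · intro m hm
    rw [Finset.mem_range] at hm
    show k - (k - m) = m
    omega
  · intro j _
    rfl

/-- **p. 272 L28–31 with a k-UNIFORM O(1)** (the absorption of GAPS G-B10-07 (b) via (44)'s exponential factor): per
level-(k+1) history `h` and field `U`, if the dropped old terms are controlled blockwise and scalewise — `hdiff`:
`|Pold − PoldIn| ≤ Σ_{j=1}^{k} Σ_{y} drop_j(y)` (triangle inequality over the carrier's definitions: the terms with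
Y_j ∌ Ω_{k+1} regrouped by their big block y); `hshell`: `drop_j(y) ≤ A₀(Lʲη)⁴·e^{−κ·dist_j(y)}` (the (45)-type sum over
Y_j ∋ y of the dropped terms, which all reach Z_k, with (44)'s decay in the shell index `dist_j(y)` of y relative to Z_k);
`hcount`: `#{y : dist_j(y) ≤ m} ≤ c_sh(m+1)³·(M₁Lʲη)⁻³|Z_k|` (Z_k is a union of scale-j big blocks; shells of a union
of blocks); `hS`: a majorant of the shell series (`shell_series_le`) — then
`OldOutside P (A₀·c_sh·S·M₁⁻³·(L/(L−1)))`, with `Lʲη = L^{j−k}` summed by the d = 3 power counting `Σ_{m<k} L^{−m}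
≤ L/(L−1)` (LQB `B10.powerCounting_d3`). [cite: Balaban1985UV3, Thm 2 proof p.272 + (44)–(46) p.267] -/
theorem oldOutside_of_shells (P : StepPieces T k) (Blk : ℕ → Type) [∀ j, Fintype (Blk j)]
    (drop : T.Hist (k + 1) → T.Cfg (k + 1) → (j : ℕ) → Blk j → ℝ)
    (dist : T.Hist (k + 1) → (j : ℕ) → Blk j → ℕ) (ℓ : ℕ → ℝ) {L M₁ A₀ κ csh S : ℝ}
    (hL : 1 < L) (hM : 0 < M₁) (hA₀ : 0 ≤ A₀) (hcsh : 0 ≤ csh) (hS0 : 0 ≤ S)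
    (hℓ : ∀ j ∈ Finset.Icc 1 k, ℓ j = L⁻¹ ^ (k - j))
    (hdiff : ∀ (h : T.Hist (k + 1)) (U : T.Cfg (k + 1)),
      |P.Pold h U - P.PoldIn h U| ≤ ∑ j ∈ Finset.Icc 1 k, ∑ y : Blk j, drop h U j y)
    (hshell : ∀ (h : T.Hist (k + 1)) (U : T.Cfg (k + 1)), ∀ j ∈ Finset.Icc 1 k, ∀ y : Blk j,
      drop h U j y ≤ A₀ * ℓ j ^ 4 * Real.exp (-(κ * dist h j y)))
    (hcount : ∀ (h : T.Hist (k + 1)), ∀ j ∈ Finset.Icc 1 k, ∀ m : ℕ,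
      ((Finset.univ.filter fun y : Blk j => dist h j y ≤ m).card : ℝ)
        ≤ csh * ((m : ℝ) + 1) ^ 3 * ((M₁ * ℓ j)⁻¹ ^ 3 * P.Zvol h))
    (hS : ∀ M : ℕ, ∑ m ∈ Finset.range M, ((m : ℝ) + 1) ^ 3 * Real.exp (-(κ * m)) ≤ S) :
    OldOutside P (A₀ * csh * S * M₁⁻¹ ^ 3 * (L / (L - 1))) := by
  intro h U
  have hL0 : 0 < L := by linarith
  have hZ := P.Zvol_nonneg h
  -- one scale
  have hscale : ∀ j ∈ Finset.Icc 1 k,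
      ∑ y : Blk j, drop h U j y ≤ A₀ * csh * S * M₁⁻¹ ^ 3 * P.Zvol h * ℓ j := by
    intro j hj
    have hℓpos : 0 < ℓ j := by rw [hℓ j hj]; positivity
    have hZb : 0 ≤ (M₁ * ℓ j)⁻¹ ^ 3 * P.Zvol h := by positivity
    have h1 := dropped_scale_le (drop h U j) (dist h j) (A := A₀ * ℓ j ^ 4) (by positivity) hcsh hZb
      (hshell h U j hj) (hcount h j hj) hS
    calc ∑ y : Blk j, drop h U j y ≤ A₀ * ℓ j ^ 4 * (csh * S * ((M₁ * ℓ j)⁻¹ ^ 3 * P.Zvol h)) := h1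
      _ = A₀ * csh * S * M₁⁻¹ ^ 3 * P.Zvol h * ℓ j := by
          have hℓ0 : ℓ j ≠ 0 := hℓpos.ne'
          have hM0 : M₁ ≠ 0 := hM.ne'
          field_simp
  -- all scales
  have hsum : ∑ j ∈ Finset.Icc 1 k, ℓ j ≤ L / (L - 1) := by
    calc ∑ j ∈ Finset.Icc 1 k, ℓ j = ∑ j ∈ Finset.Icc 1 k, L⁻¹ ^ (k - j) := Finset.sum_congr rfl hℓ
      _ = ∑ m ∈ Finset.range k, L⁻¹ ^ m := sum_Icc_pow_sub L⁻¹ k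
      _ ≤ L / (L - 1) := by simpa using B10.powerCounting_d3 L hL k
  have hK : 0 ≤ A₀ * csh * S * M₁⁻¹ ^ 3 * P.Zvol h := by
    have : 0 ≤ M₁⁻¹ := inv_nonneg.mpr hM.le
    positivity
  calc |P.Pold h U - P.PoldIn h U| ≤ ∑ j ∈ Finset.Icc 1 k, ∑ y : Blk j, drop h U j y := hdiff h U
    _ ≤ ∑ j ∈ Finset.Icc 1 k, A₀ * csh * S * M₁⁻¹ ^ 3 * P.Zvol h * ℓ j := Finset.sum_le_sum hscale
    _ = A₀ * csh * S * M₁⁻¹ ^ 3 * P.Zvol h * ∑ j ∈ Finset.Icc 1 k, ℓ j := by rw [Finset.mul_sum]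
    _ ≤ A₀ * csh * S * M₁⁻¹ ^ 3 * P.Zvol h * (L / (L - 1)) := mul_le_mul_of_nonneg_left hsum hK
    _ = A₀ * csh * S * M₁⁻¹ ^ 3 * (L / (L - 1)) * P.Zvol h := by ring

/-- **p. 272 L28–31 with a k-UNIFORM O(1), blocks as history-dependent finite sets** (the carrier's form: the
scale-j big blocks `blocks h j : Finset (Site j)` that can carry dropped terms): same mechanism and constant as
`oldOutside_of_shells`. [cite: Balaban1985UV3, Thm 2 proof p.272 + (44)–(46) p.267] -/
theorem oldOutside_of_shells_finset (P : StepPieces T k) (Site : ℕ → Type)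
    (blocks : T.Hist (k + 1) → (j : ℕ) → Finset (Site j))
    (drop : T.Hist (k + 1) → T.Cfg (k + 1) → (j : ℕ) → Site j → ℝ)
    (dist : T.Hist (k + 1) → (j : ℕ) → Site j → ℕ) (ℓ : ℕ → ℝ) {L M₁ A₀ κ csh S : ℝ}
    (hL : 1 < L) (hM : 0 < M₁) (hA₀ : 0 ≤ A₀) (hcsh : 0 ≤ csh) (hS0 : 0 ≤ S)
    (hℓ : ∀ j ∈ Finset.Icc 1 k, ℓ j = L⁻¹ ^ (k - j))
    (hdiff : ∀ (h : T.Hist (k + 1)) (U : T.Cfg (k + 1)),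
      |P.Pold h U - P.PoldIn h U| ≤ ∑ j ∈ Finset.Icc 1 k, ∑ y ∈ blocks h j, drop h U j y)
    (hshell : ∀ (h : T.Hist (k + 1)) (U : T.Cfg (k + 1)), ∀ j ∈ Finset.Icc 1 k, ∀ y ∈ blocks h j,
      drop h U j y ≤ A₀ * ℓ j ^ 4 * Real.exp (-(κ * dist h j y)))
    (hcount : ∀ (h : T.Hist (k + 1)), ∀ j ∈ Finset.Icc 1 k, ∀ m : ℕ,
      (((blocks h j).filter fun y => dist h j y ≤ m).card : ℝ)
        ≤ csh * ((m : ℝ) + 1) ^ 3 * ((M₁ * ℓ j)⁻¹ ^ 3 * P.Zvol h))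
    (hS : ∀ M : ℕ, ∑ m ∈ Finset.range M, ((m : ℝ) + 1) ^ 3 * Real.exp (-(κ * m)) ≤ S) :
    OldOutside P (A₀ * csh * S * M₁⁻¹ ^ 3 * (L / (L - 1))) := by
  intro h U
  have hL0 : 0 < L := by linarith
  have hZ := P.Zvol_nonneg h
  have hscale : ∀ j ∈ Finset.Icc 1 k,
      ∑ y ∈ blocks h j, drop h U j y ≤ A₀ * csh * S * M₁⁻¹ ^ 3 * P.Zvol h * ℓ j := by
    intro j hj
    have hℓpos : 0 < ℓ j := by rw [hℓ j hj]; positivity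
    have hZb : 0 ≤ (M₁ * ℓ j)⁻¹ ^ 3 * P.Zvol h := by positivity
    have h1 := dropped_scale_le_finset (blocks h j) (drop h U j) (dist h j) (A := A₀ * ℓ j ^ 4) (by positivity)
      hcsh hZb (hshell h U j hj) (hcount h j hj) hS
    calc ∑ y ∈ blocks h j, drop h U j y ≤ A₀ * ℓ j ^ 4 * (csh * S * ((M₁ * ℓ j)⁻¹ ^ 3 * P.Zvol h)) := h1
      _ = A₀ * csh * S * M₁⁻¹ ^ 3 * P.Zvol h * ℓ j := by
          have hℓ0 : ℓ j ≠ 0 := hℓpos.ne'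
          have hM0 : M₁ ≠ 0 := hM.ne'
          field_simp
  have hsum : ∑ j ∈ Finset.Icc 1 k, ℓ j ≤ L / (L - 1) := by
    calc ∑ j ∈ Finset.Icc 1 k, ℓ j = ∑ j ∈ Finset.Icc 1 k, L⁻¹ ^ (k - j) := Finset.sum_congr rfl hℓ
      _ = ∑ m ∈ Finset.range k, L⁻¹ ^ m := sum_Icc_pow_sub L⁻¹ k
      _ ≤ L / (L - 1) := by simpa using B10.powerCounting_d3 L hL k
  have hK : 0 ≤ A₀ * csh * S * M₁⁻¹ ^ 3 * P.Zvol h := by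
    have : 0 ≤ M₁⁻¹ := inv_nonneg.mpr hM.le
    positivity
  calc |P.Pold h U - P.PoldIn h U| ≤ ∑ j ∈ Finset.Icc 1 k, ∑ y ∈ blocks h j, drop h U j y := hdiff h U
    _ ≤ ∑ j ∈ Finset.Icc 1 k, A₀ * csh * S * M₁⁻¹ ^ 3 * P.Zvol h * ℓ j := Finset.sum_le_sum hscale
    _ = A₀ * csh * S * M₁⁻¹ ^ 3 * P.Zvol h * ∑ j ∈ Finset.Icc 1 k, ℓ j := by rw [Finset.mul_sum]
    _ ≤ A₀ * csh * S * M₁⁻¹ ^ 3 * P.Zvol h * (L / (L - 1)) := mul_le_mul_of_nonneg_left hsum hK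
    _ = A₀ * csh * S * M₁⁻¹ ^ 3 * (L / (L - 1)) * P.Zvol h := by ring

end AllScales

end Summit.QuantumFields.Balaban3D.Proofs
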